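import Summits.BirchSwinnertonDyer.Rank1Residual.X11b.AnticyclotomicSplitPlaces
import Literature.NumberTheory.EllipticCurves.PeriodIndexFrobeniusTorsion
import HarnessLib

/-!
# X11b, route R1 — Greenberg's Lemma 3.3 at the GOOD places `v ∤ p`: `H¹(K_v, E[p^∞]) ↪ H¹(I_v, E[p^∞])`,
# so Castella's away condition DESCENDS at every good `v ∤ p` for EVERY `ℤ_p`-extension

HONEST FRAMING (cell `b2b-bsdres`, run/shared/lean/b2b/bsd-rank1-residual/, verbatim in every
file): the goal of the cell is to DELETE the COMBINATION-SHAPED residual classes of the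
Birch–Swinnerton-Dyer formula for ALL analytic-rank `≤ 1` elliptic curves over `ℚ` — "full BSD
formula for every rank `≤ 1` curve in class `C`" assembled STRICTLY from published theorems — so
that the rank-`≤ 1` remainder becomes exactly the CONSTRUCTION-SHAPED classes, which are TYPED
(missing-input `Prop`s), NOT attempted. This is not "finishing BSD". Sub-cell
`b2b-bsdres-multr1-p1` (X11b, route R1 = Castella 2018 Thm. A re-proved along the author's
erratum); a RESEARCH ROUTE; no claim beyond the stated class; X11b stays CONSTRUCTION-SHAPED;
nothing here changes a label; no named fact is minted (proved theorems only; no `sorry`).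

## Why this file

Gen 10 (`AnticyclotomicControlCokernel`, `AnticyclotomicInfinitePlaces`) reduced the control
isomorphism `s : Sel_𝔭^Σ(K, E[p^∞]) ≅ Sel_𝔭^Σ(K_∞, E[p^∞])^Γ` (Cas18 Thm. 2.3 ⇐ JSW17 §3.3 /
Greenberg LNM 1716 §3) on the constructed objects to ONE residual input `hS`: at every finite place
`v ∉ Σ`, `v ∤ p`, Castella's AWAY condition (local triviality) must descend from `K_∞` to `K`, i.e.
Greenberg's local kernel `ker(H¹(K_v, E[p^∞]) → H¹(K_{∞,w}, E[p^∞]))` must vanish. This file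
PROVES that kernel vanishes at every place of GOOD reduction `v ∤ p`, for every number field `K`,
every elliptic `E/K` and every `ℤ_p`-extension (Greenberg, LNM 1716, Lemma 3.3, good case, p. 87:
"if `E` has good reduction at `v`, … `ker(r_v) = 0`"), in the slightly stronger form

  `res : H¹(D_v, E[p^∞]) → H¹(I_v, E[p^∞])` is INJECTIVE (`H¹_ur(K_v, E[p^∞]) = 0`),

where `D_v ⊇ I_v` are the decomposition and inertia groups of the prime `𝔓₀ ∣ v` of `\bar ℤ_K` cut
out by the chosen embedding. Since every `ℤ_p`-extension is unramified at `v ∤ p`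
(`I_v ≤ ker κ`, tree `ZpExtension.inertia_le_kerSubgroup_holds`), injectivity to `I_v` gives
injectivity to `D_v ⊓ ker κ`, which is the descent of the away condition. Consequently the
hypothesis `hS` of `controlMap_bijective_of_away_descent` HOLDS as soon as `Σ` contains the bad
places `v ∤ p` (companion file `AnticyclotomicControlBadImprimitive.lean`: the bad-imprimitive
control map is bijective — Greenberg's "non-primitive Selmer groups are exactly controlled").

## The argument (Greenberg LNM 1716 §3 p. 87; Serre, *Local Fields*, XIII §1; here on cocycles)

* `resOfLe_injective_of_frobenius_generation` (generic, `Γ_K`-subgroups `I ≤ D`, `φ ∈ D`): if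
  `D = ⟨φ⟩·I·U` for every open subgroup `U` (tree `exists_eq_frobenius_pow_mul_of_mem_decompositionSubgroup`),
  `I` acts trivially on the discrete module `M`, and `φ − 1` is ONTO `M`, then
  `res : H¹(D, M) → H¹(I, M)` is injective: a cocycle `ψ` dying on `I` vanishes on `I` (trivial
  action); pick `b` with `φb − b = ψ(φ)`; `ψ' = ψ − ∂b` vanishes at `φ` and on `I`, hence on
  `⟨φ⟩·I`; its zero set is an OPEN SUBGROUP of `D` (cocycle identity + continuity into discrete
  `M`), which contains `D ∩ U` for an open subgroup `U ≤ Γ_K` (Krull topology,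
  `krullTopology_mem_nhds_one_iff`); so `ψ' = 0` by the generation hypothesis.
* `exists_frob_smul_sub_eq` (elliptic curves): at a good `v ∤ p`, for EVERY arithmetic Frobenius `φ`
  at EVERY `𝔓 ∣ v`, `φ − 1` is onto `E[p^∞]` — the tree's
  `exists_mem_geomPrimaryTorsion_frobenius_pow_sub_eq` (for the local Frobenius along the chosen
  embedding; kernel finite by reduction mod `𝔓`, `E(K̄)` divisible) transported to `𝔓` by
  transitivity (`exists_smul_eq_of_mem_primesAbove_holds`, `IsArithFrobAt.conj`) and to `φ` by
  `IsArithFrobAt.mul_inv_mem_inertia` + Silverman VII.4.1(a) (inertia fixes `E[p^∞]`,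
  `smul_eq_of_mem_inertia_of_nsmul_eq_zero`).
* `resOfLe_inertia_injective_of_hasGoodReductionAt`: **`H¹(D_v, E[p^∞]) ↪ H¹(I_v, E[p^∞])`**;
  `resOfLe_mem_awayKer_iff_of_hasGoodReductionAt`: for ANY `H ≥ I_v` (e.g. `H = ker κ`), a class
  `c ∈ H¹(K, E[p^∞])` is locally trivial at `v` iff `res_{K→K̄^H} c` is locally trivial at the chosen
  place above `v` — the away condition DESCENDS at good `v ∤ p`.
* Companion file `AnticyclotomicControlBadImprimitive.lean`: hence, for totally complex `K` and any
  `Σ ⊇ {v ∤ p of bad reduction}`, `s : Sel_𝔭^Σ(K, E[p^∞]) → Sel_𝔭^Σ(K_∞, E[p^∞])^γ` is BIJECTIVE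
  (route R1: `ChainLocus`, every imaginary quadratic `K` / erratum field, degree-one `𝔭 ∣ p`).

What is NOT here: the local kernels at the BAD places (`#ker r_v = c_v^{(p)}` at bad `v ∤ p` finitely
decomposed — the Tamagawa factors `∏_{w∣N⁺} c_w^{(p)}` of Cas18 Thm. 2.3 / (5.2)), the order of
`Sel_𝔭(K, E[p^∞])` (JSW §3.3.5, Poitou–Tate) and `Sel_Γ = 0` (§3.3.6). No label changes.

References: [GreenbergLNM1716] §3 Lemma 3.3 and p. 87, Thm. 1.2 (p. 90); [JetchevSkinnerWan2017]
§3.3 (arXiv:1512.06894; shape only); [Castella2018] Def. 2.2, Thm. 2.3 (arXiv:1704.06608 p. 5);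
[SilvermanAEC2009] Prop. VII.4.1; [NeukirchANT1999] I §9 (9.4); [SerreGaloisCohomology1997] I.§2, I.§5.
-/

noncomputable section

open scoped Classical Topology

open NumberField IsDedekindDomain Field
open Literature.NumberTheory.EllipticCurves Literature.NumberTheory.EllipticCurves.GreenbergSelmer
open Literature.NumberTheory.GaloisRepresentations IsDedekindDomain.HeightOneSpectrum

universe u

namespace Summit.BirchSwinnertonDyer.Rank1Residual.X11b.AcSelmer

/-! ## Generic: `res : H¹(D, M) → H¹(I, M)` injective from Frobenius generation -/

section Generic

variable {K : Type u} [Field K]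
variable {M : Type u} [AddCommGroup M] [DistribMulAction (absoluteGaloisGroup K) M]
  [TopologicalSpace M] [DiscreteTopology M]

/-- **Injectivity of `res : H¹(D, M) → H¹(I, M)` from "`D` is generated by `φ` and `I`".** Let
`I ≤ D ≤ Γ_K`, `φ ∈ D`, and suppose every `d ∈ D` is `φⁿ·i·u` with `i ∈ I`, `u ∈ U` for EVERY open
subgroup `U ≤ Γ_K`; let `M` be a discrete `Γ_K`-module with continuous orbit maps on which `I` acts
trivially and `φ − 1` is onto. Then a class of `H¹(D, M)` restricting to `0` on `I` is `0`: its
cocycle `ψ` vanishes on `I`; with `φ b − b = ψ(φ)`, `ψ − ∂b` vanishes at `φ`, on `I`, on `⟨φ⟩·I`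
(cocycle identity) and on `D ∩ U` for the open subgroup `U` inside its (open) zero set
(`krullTopology_mem_nhds_one_iff`), hence everywhere. ("`ker(res) = H¹(D/I, M^I) = M/(φ−1)M = 0`".)
[cite: SerreGaloisCohomology1997, I.§2.6 (b) and I.§5.1] [cite: GreenbergLNM1716, §3 Lemma 3.3 (p. 87)] -/
theorem resOfLe_injective_of_frobenius_generation {I D : Subgroup (absoluteGaloisGroup K)}
    (hID : I ≤ D) {φ : absoluteGaloisGroup K} (hφD : φ ∈ D)
    (hgen : ∀ U : Subgroup (absoluteGaloisGroup K), IsOpen (U : Set (absoluteGaloisGroup K)) →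
      ∀ d ∈ D, ∃ (n : ℕ) (i u : absoluteGaloisGroup K), i ∈ I ∧ u ∈ U ∧ d = φ ^ n * i * u)
    (hcont : ∀ m : M, Continuous fun g : absoluteGaloisGroup K ↦ g • m)
    (hI : ∀ i ∈ I, ∀ m : M, i • m = m) (hsurj : ∀ m : M, ∃ b : M, φ • b - b = m) :
    Function.Injective (resOfLe M hID) := by
  rw [injective_iff_map_eq_zero]
  intro c hc
  obtain ⟨ψ, rfl⟩ := oneCocycleClass_surjective _ c
  -- the restricted class is the class of the pulled-back cocycle; it is a coboundary
  have hres : resOfLe M hID (oneCocycleClass _ ψ) = oneCocycleClass _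
      (contOneCocycles.pullback (subgroupInclusion hID)
        (resHomOfEquivariant (subgroupInclusion hID) (AddMonoidHom.id M) (fun _ _ ↦ rfl)) ψ) :=
    map_oneCocycleClass _ _ _ ψ
  rw [hres, oneCocycleClass_eq_zero_iff] at hc
  obtain ⟨v, hv⟩ := hc
  -- `ψ` vanishes on `I` (trivial action)
  have hψI : ∀ (i : absoluteGaloisGroup K) (hi : i ∈ I), ψ.1 ⟨i, hID hi⟩ = 0 := by
    intro i hi
    have key := hv ⟨i, hi⟩
    rw [contOneCocycles.pullback_apply] at key
    change ψ.1 (subgroupInclusion hID ⟨i, hi⟩) = (⟨i, hi⟩ : I) • v - v at key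
    have e : subgroupInclusion hID ⟨i, hi⟩ = ⟨i, hID hi⟩ := Subtype.ext rfl
    rw [e] at key
    rw [key]
    change i • v - v = 0
    rw [hI i hi v, sub_self]
  -- subtract the coboundary of `b`, `φ b - b = ψ(φ)`
  obtain ⟨b, hb⟩ := hsurj (ψ.1 ⟨φ, hφD⟩)
  have hcontb : Continuous fun g : D ↦ g • b := (hcont b).comp continuous_subtype_val
  set ψ' := ψ - cobCocycle b hcontb with hψ'
  have hψ'φ : ψ'.1 ⟨φ, hφD⟩ = 0 := by
    rw [hψ', Submodule.coe_sub, ContinuousMap.sub_apply, cobCocycle_apply]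
    change ψ.1 ⟨φ, hφD⟩ - (φ • b - b) = 0
    rw [hb, sub_self]
  have hψ'I : ∀ (i : absoluteGaloisGroup K) (hi : i ∈ I), ψ'.1 ⟨i, hID hi⟩ = 0 := by
    intro i hi
    rw [hψ', Submodule.coe_sub, ContinuousMap.sub_apply, cobCocycle_apply, hψI i hi]
    change 0 - (i • b - b) = 0
    rw [hI i hi b, sub_self, sub_zero]
  -- cocycle identity
  have hmul : ∀ x y : D, ψ'.1 (x * y) = ψ'.1 x + (x : absoluteGaloisGroup K) • ψ'.1 y :=
    fun x y ↦ ψ'.2 x y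
  have hpow : ∀ n : ℕ, ψ'.1 (⟨φ, hφD⟩ ^ n) = 0 := by
    intro n
    induction n with
    | zero => rw [pow_zero]; exact contOneCocycles.apply_one ψ'
    | succ n ih => rw [pow_succ, hmul, ih, hψ'φ, smul_zero, add_zero]
  -- the zero set of `ψ'` is open in `D`; it contains `D ∩ U` for an open subgroup `U ≤ Γ_K`
  have hopen : IsOpen ((fun x : D ↦ ψ'.1 x) ⁻¹' {0}) :=
    (isOpen_discrete ({0} : Set M)).preimage ψ'.1.continuous
  obtain ⟨V, hV, hVeq⟩ := isOpen_induced_iff.mp hopen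
  have h1V : (1 : absoluteGaloisGroup K) ∈ V := by
    have h1 : (1 : D) ∈ (fun x : D ↦ ψ'.1 x) ⁻¹' {0} := contOneCocycles.apply_one ψ'
    rw [← hVeq] at h1
    exact h1
  obtain ⟨F, hFfin, hFV⟩ :=
    (krullTopology_mem_nhds_one_iff K (AlgebraicClosure K) V).mp (hV.mem_nhds h1V)
  haveI := hFfin
  have hU0 : ∀ (u : absoluteGaloisGroup K) (hu : u ∈ F.fixingSubgroup) (huD : u ∈ D),
      ψ'.1 ⟨u, huD⟩ = 0 := by
    intro u hu huD
    have h : (⟨u, huD⟩ : D) ∈ Subtype.val ⁻¹' V := hFV hu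
    rw [hVeq] at h
    exact h
  -- `ψ' = 0`
  have hψ'0 : ψ' = 0 := by
    apply Subtype.ext
    ext d
    obtain ⟨n, i, u, hi, hu, hd⟩ := hgen F.fixingSubgroup (IntermediateField.fixingSubgroup_isOpen F) d d.2
    have huD : u ∈ D := by
      have e : u = (φ ^ n * i)⁻¹ * d := by rw [hd, inv_mul_cancel_left]
      rw [e]
      exact D.mul_mem (D.inv_mem (D.mul_mem (D.pow_mem hφD n) (hID hi))) d.2
    have e : d = ⟨φ, hφD⟩ ^ n * ⟨i, hID hi⟩ * ⟨u, huD⟩ :=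
      Subtype.ext (by simp only [Subgroup.coe_mul, SubgroupClass.coe_pow]; exact hd)
    rw [e, hmul, hmul, hpow n, hψ'I i hi, hU0 u hu huD]
    simp only [smul_zero, add_zero]
    rfl
  have hcls : oneCocycleClass _ ψ - oneCocycleClass _ (cobCocycle b hcontb) = 0 := by
    rw [← oneCocycleClass_sub, ← hψ', hψ'0, oneCocycleClass_zero]
  rwa [oneCocycleClass_cobCocycle, sub_zero] at hcls

end Generic

/-! ## Elliptic curves: at a good `v ∤ p`, `φ − 1` is onto `E[p^∞]` for every Frobenius `φ` -/

section Curve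

variable {K : Type} [Field K] [NumberField K] (E : WeierstrassCurve K) [E.IsElliptic]
  (p : ℕ) [Fact p.Prime]

omit [Fact p.Prime] in
/-- **Silverman VII.4.1(a) on `E[p^∞]`**: the inertia group of any prime `𝔓 ∣ v` of `\bar ℤ_K`, `v ∤ p`
of good reduction, acts trivially on `E(K̄)[p^∞]`. [cite: SilvermanAEC2009, Prop. VII.4.1(a)] -/
theorem smul_geomPrimaryTorsion_eq_of_mem_inertia {v : HeightOneSpectrum (𝓞 K)}
    (hpv : (p : 𝓞 K) ∉ v.asIdeal) (hv : E.HasGoodReductionAt v)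
    {𝔓 : Ideal (absIntegers (𝓞 K) K)} (h𝔓 : 𝔓 ∈ v.primesAbove)
    {τ : absoluteGaloisGroup K} (hτ : τ ∈ 𝔓.inertia (absoluteGaloisGroup K))
    (x : E.geomPrimaryTorsion p) : τ • x = x := by
  obtain ⟨k, hk⟩ := x.2
  have hpk : (((p ^ k : ℕ) : ℤ) : 𝓞 K) ∉ v.asIdeal := WeierstrassCurve.pow_natCast_not_mem hpv k
  have hpk' : ((p ^ k : ℕ) : 𝓞 K) ∉ v.asIdeal := by rwa [Int.cast_natCast] at hpk
  exact Subtype.ext (E.smul_eq_of_mem_inertia_of_nsmul_eq_zero hv hpk' h𝔓 hτ hk)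

/-- **At a good `v ∤ p`, `φ − 1` is ONTO `E[p^∞]` for EVERY arithmetic Frobenius `φ` at EVERY `𝔓 ∣ v`.**
The tree proves it for the restriction `σ₀` of a local Frobenius along the chosen embedding
`ι : K̄ → K̄_v`, a Frobenius at the prime `𝔓_{ι,𝔐}` (`exists_mem_geomPrimaryTorsion_frobenius_pow_sub_eq`,
`f = 1`); transport: `τ • 𝔓_{ι,𝔐} = 𝔓` for some `τ` (transitivity), `γ = τ σ₀ τ⁻¹` is a Frobenius
at `𝔓` with `γ(τz) − τz = τ(σ₀ z − z)`, and `φ γ⁻¹ ∈ I_𝔓` acts trivially on `E[p^∞]`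
(VII.4.1(a)), so `φ b = γ b`. [cite: GreenbergLNM1716, §3 Lemma 3.3 (p. 87), good case] [cite: SilvermanAEC2009, Prop. VII.4.1] -/
theorem exists_frob_smul_sub_eq {v : HeightOneSpectrum (𝓞 K)}
    (hpv : (p : 𝓞 K) ∉ v.asIdeal) (hv : E.HasGoodReductionAt v)
    {𝔓 : Ideal (absIntegers (𝓞 K) K)} (h𝔓 : 𝔓 ∈ v.primesAbove)
    {φ : absoluteGaloisGroup K} (hφ : IsArithFrobAt (𝓞 K) φ 𝔓) (m : E.geomPrimaryTorsion p) :
    ∃ b : E.geomPrimaryTorsion p, φ • b - b = m := by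
  obtain ⟨𝔐, h𝔐⟩ := v.localPrimesAbove_nonempty
  set ι := closureEmb (K := K) (v.adicCompletion K) with hι
  obtain ⟨σL, hσL⟩ := v.exists_isArithFrobAt_localAbsIntegers h𝔐
  set σ₀ : absoluteGaloisGroup K := resGalOfEmb ι σL with hσ₀
  have h𝔓₁ : v.primeBelow ι 𝔐 ∈ v.primesAbove := primeBelow_mem_primesAbove h𝔐
  have hσ₀F : IsArithFrobAt (𝓞 K) σ₀ (v.primeBelow ι 𝔐) :=
    WeierstrassCurve.isArithFrobAt_resGalOfEmb h𝔐 ι hσL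
  obtain ⟨τ, hτ⟩ := exists_smul_eq_of_mem_primesAbove_holds h𝔓₁ h𝔓
  have hγ : IsArithFrobAt (𝓞 K) (τ * σ₀ * τ⁻¹) 𝔓 := hτ ▸ hσ₀F.conj τ
  have hIn : φ * (τ * σ₀ * τ⁻¹)⁻¹ ∈ 𝔓.inertia (absoluteGaloisGroup K) := hφ.mul_inv_mem_inertia hγ
  -- surjectivity of `σ₀ - 1`, applied to `τ⁻¹ • m`
  obtain ⟨z, hz, hzeq⟩ := exists_mem_geomPrimaryTorsion_frobenius_pow_sub_eq E hpv hv h𝔐 ι hσL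
    Nat.one_pos (a := ((τ⁻¹ • m : E.geomPrimaryTorsion p) : E.geomPoints)) (τ⁻¹ • m).2
  rw [pow_one] at hzeq
  refine ⟨τ • ⟨z, hz⟩, ?_⟩
  -- `φ • b = γ • b`
  have hφb : φ • (τ • (⟨z, hz⟩ : E.geomPrimaryTorsion p)) =
      (τ * σ₀ * τ⁻¹) • (τ • (⟨z, hz⟩ : E.geomPrimaryTorsion p)) := by
    conv_lhs => rw [← inv_mul_cancel_right φ (τ * σ₀ * τ⁻¹), mul_smul]
    rw [smul_geomPrimaryTorsion_eq_of_mem_inertia E p hpv hv h𝔓 hIn]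
  rw [hφb]
  apply Subtype.ext
  have h1 : (((τ * σ₀ * τ⁻¹) • (τ • (⟨z, hz⟩ : E.geomPrimaryTorsion p)) -
      τ • (⟨z, hz⟩ : E.geomPrimaryTorsion p) : E.geomPrimaryTorsion p) : E.geomPoints) =
      τ • (σ₀ • z - z) := by
    rw [AddSubgroupClass.coe_sub, primaryComponent.coe_smul, primaryComponent.coe_smul, smul_sub,
      ← mul_smul, ← mul_smul, inv_mul_cancel_right, mul_smul]
  rw [h1, hzeq, primaryComponent.coe_smul, ← mul_smul, mul_inv_cancel, one_smul]

/-- `I_v ≤ D_v` for the chosen prime `𝔓₀ = adicCompletionPrime K v` (`decomp v = D_{𝔓₀}`,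
`decompositionSubgroup_adicCompletionPrime_eq_range`). [cite: NeukirchANT1999, Ch. I §9 (9.5)–(9.6)] -/
theorem inertia_adicCompletionPrime_le_decomp (v : HeightOneSpectrum (𝓞 K)) :
    (adicCompletionPrime K v).inertia (absoluteGaloisGroup K) ≤ decomp v := by
  have e : decomp v = (adicCompletionPrime K v).decompositionSubgroup (absoluteGaloisGroup K) := by
    rw [decompositionSubgroup_adicCompletionPrime_eq_range]; rfl
  rw [e]
  exact Ideal.inertia_le_decompositionSubgroup _ _

/-- **Greenberg's Lemma 3.3, good case, on cocycles: `H¹(D_v, E[p^∞]) ↪ H¹(I_v, E[p^∞])`** — for an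
elliptic curve `E` over a number field `K`, a prime `p` and a finite place `v ∤ p` of GOOD reduction,
the restriction from the decomposition group to the inertia group of the chosen prime `𝔓₀ ∣ v` is
injective on `H¹(·, E(K̄)[p^∞])`; equivalently `H¹_ur(K_v, E[p^∞]) = E[p^∞]/(Frob_v − 1) = 0`.
From `resOfLe_injective_of_frobenius_generation` (generation: tree
`exists_eq_frobenius_pow_mul_of_mem_decompositionSubgroup`; trivial inertia: VII.4.1(a); `φ − 1`
onto: `exists_frob_smul_sub_eq`). [cite: GreenbergLNM1716, §3 Lemma 3.3 (p. 87), "if E has good reduction at v … ker(r_v) = 0"]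
[cite: NeukirchANT1999, I §9 Prop. (9.4)] -/
theorem resOfLe_inertia_injective_of_hasGoodReductionAt {v : HeightOneSpectrum (𝓞 K)}
    (hpv : (p : 𝓞 K) ∉ v.asIdeal) (hv : E.HasGoodReductionAt v) :
    Function.Injective
      (resOfLe (E.geomPrimaryTorsion p) (inertia_adicCompletionPrime_le_decomp v)) := by
  have h𝔓₀ := adicCompletionPrime_mem_primesAbove K v
  haveI : (adicCompletionPrime K v).IsPrime := h𝔓₀.1
  have e : decomp v = (adicCompletionPrime K v).decompositionSubgroup (absoluteGaloisGroup K) := by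
    rw [decompositionSubgroup_adicCompletionPrime_eq_range]; rfl
  obtain ⟨φ, hφ⟩ := exists_isArithFrobAt_of_mem_primesAbove_holds h𝔓₀
  have hφD : φ ∈ decomp v := by rw [e]; exact hφ.mem_stabilizer
  refine resOfLe_injective_of_frobenius_generation (inertia_adicCompletionPrime_le_decomp v) hφD
    (fun U hU d hd ↦ ?_) (E.continuous_smul_geomPrimaryTorsion p)
    (fun i hi m ↦ smul_geomPrimaryTorsion_eq_of_mem_inertia E p hpv hv h𝔓₀ hi m)
    (exists_frob_smul_sub_eq E p hpv hv h𝔓₀ hφ)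
  rw [e] at hd
  exact exists_eq_frobenius_pow_mul_of_mem_decompositionSubgroup h𝔓₀ hφ hU hd

/-- The same with `⊤ ⊓ D_v` for `D_v` (the shape in which `awayKer ⊤` is defined).
[cite: GreenbergLNM1716, §3 Lemma 3.3 (p. 87)] -/
theorem resOfLe_inertia_top_inf_injective_of_hasGoodReductionAt {v : HeightOneSpectrum (𝓞 K)}
    (hpv : (p : 𝓞 K) ∉ v.asIdeal) (hv : E.HasGoodReductionAt v)
    (h : (adicCompletionPrime K v).inertia (absoluteGaloisGroup K) ≤ ⊤ ⊓ decomp v) :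
    Function.Injective (resOfLe (E.geomPrimaryTorsion p) h) := by
  have h1 : decomp v ≤ ⊤ ⊓ decomp v := fun g hg ↦ Subgroup.mem_inf.mpr ⟨Subgroup.mem_top g, hg⟩
  have e : resOfLe (E.geomPrimaryTorsion p) h =
      (resOfLe (E.geomPrimaryTorsion p) (inertia_adicCompletionPrime_le_decomp v)).comp
        (resOfLe (E.geomPrimaryTorsion p) h1) :=
    (resOfLe_comp_holds (inertia_adicCompletionPrime_le_decomp v) h1).symm
  rw [e, AddMonoidHom.coe_comp]
  exact (resOfLe_inertia_injective_of_hasGoodReductionAt E p hpv hv).comp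
    (resOfLe_injective_of_ge _ h1 inf_le_right)

/-- **The AWAY condition DESCENDS at a good `v ∤ p`, for every `H ≥ I_v`** (e.g. `H = ker κ` for any
`ℤ_p`-extension `κ`): for `c ∈ H¹(⊤, E[p^∞]) = H¹(K, E[p^∞])`, `res_{K→K̄^H} c` is locally trivial at
the chosen place above `v` iff `c` is locally trivial at `v`. (→: both restrict to the same class on
`I_v`, namely `0`, and `H¹(⊤ ⊓ D_v, E[p^∞]) ↪ H¹(I_v, E[p^∞])`; ←: functoriality.) This is the
vanishing of Greenberg's `ker(r_v)` at the good places. [cite: GreenbergLNM1716, §3 Lemma 3.3 (p. 87)] [cite: JetchevSkinnerWan2017, §3.3 (control; shape only)] -/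
theorem resOfLe_mem_awayKer_iff_of_hasGoodReductionAt {v : HeightOneSpectrum (𝓞 K)}
    (hpv : (p : 𝓞 K) ∉ v.asIdeal) (hv : E.HasGoodReductionAt v)
    {H : Subgroup (absoluteGaloisGroup K)}
    (hIH : (adicCompletionPrime K v).inertia (absoluteGaloisGroup K) ≤ H)
    (c : E.subgroupH1 p (⊤ : Subgroup (absoluteGaloisGroup K))) :
    resOfLe (E.geomPrimaryTorsion p) (le_top : H ≤ ⊤) c ∈ awayKer H (E.geomPrimaryTorsion p) v ↔
      c ∈ awayKer ⊤ (E.geomPrimaryTorsion p) v := by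
  refine ⟨fun hc ↦ ?_, resOfLe_mem_awayKer le_top v⟩
  rw [awayKer, AddMonoidHom.mem_ker] at hc ⊢
  -- both sides restrict to `0` on `I_v`
  have hIHD : (adicCompletionPrime K v).inertia (absoluteGaloisGroup K) ≤ H ⊓ decomp v :=
    le_inf hIH (inertia_adicCompletionPrime_le_decomp v)
  have hITD : (adicCompletionPrime K v).inertia (absoluteGaloisGroup K) ≤ ⊤ ⊓ decomp v :=
    le_inf le_top (inertia_adicCompletionPrime_le_decomp v)
  have e2 : resOfLe (E.geomPrimaryTorsion p) hIHD (resOfLe (E.geomPrimaryTorsion p)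
      (inf_le_left : H ⊓ decomp v ≤ H) (resOfLe (E.geomPrimaryTorsion p) (le_top : H ≤ ⊤) c)) =
      resOfLe (E.geomPrimaryTorsion p)
        ((hIHD.trans (inf_le_left : H ⊓ decomp v ≤ H)).trans (le_top : H ≤ ⊤)) c := by
    rw [← AddMonoidHom.comp_apply, ← AddMonoidHom.comp_apply, resOfLe_comp_holds,
      resOfLe_comp_holds]
  rw [hc, map_zero] at e2
  have e1 : resOfLe (E.geomPrimaryTorsion p) hITD (resOfLe (E.geomPrimaryTorsion p)
      (inf_le_left : ⊤ ⊓ decomp v ≤ ⊤) c) =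
      resOfLe (E.geomPrimaryTorsion p) ((hITD.trans (inf_le_left : ⊤ ⊓ decomp v ≤ ⊤))) c := by
    rw [← AddMonoidHom.comp_apply, resOfLe_comp_holds]
  have h0 : resOfLe (E.geomPrimaryTorsion p) hITD (resOfLe (E.geomPrimaryTorsion p)
      (inf_le_left : ⊤ ⊓ decomp v ≤ ⊤) c) = 0 := by
    rw [e1]; exact e2.symm
  exact (injective_iff_map_eq_zero _).mp
    (resOfLe_inertia_top_inf_injective_of_hasGoodReductionAt E p hpv hv hITD) _ h0

/-- **… in particular for every `ℤ_p`-extension `κ`** (`I_v ≤ ker κ`: `ℤ_p`-extensions are unramified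
outside `p`, tree `ZpExtension.inertia_le_kerSubgroup_holds`): at a good `v ∤ p` Castella's away
condition over `K_∞` after restriction IFF over `K`. [cite: GreenbergLNM1716, §3 Lemma 3.3 (p. 87)] [cite: Washington1997, Prop. 13.2] -/
theorem resOfLe_mem_awayKer_kerSubgroup_iff_of_hasGoodReductionAt (κ : ZpExtension K p)
    {v : HeightOneSpectrum (𝓞 K)} (hpv : (p : 𝓞 K) ∉ v.asIdeal) (hv : E.HasGoodReductionAt v)
    (c : E.subgroupH1 p (⊤ : Subgroup (absoluteGaloisGroup K))) :
    resOfLe (E.geomPrimaryTorsion p) (le_top : κ.kerSubgroup ≤ ⊤) c ∈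
        awayKer κ.kerSubgroup (E.geomPrimaryTorsion p) v ↔
      c ∈ awayKer ⊤ (E.geomPrimaryTorsion p) v :=
  resOfLe_mem_awayKer_iff_of_hasGoodReductionAt E p hpv hv
    (ZpExtension.inertia_le_kerSubgroup_holds K p κ hpv (adicCompletionPrime_mem_primesAbove K v)) c

end Curve

end Summit.BirchSwinnertonDyer.Rank1Residual.X11b.AcSelmer

end
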